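import Literature.MathematicalPhysics.QuantumFieldTheory.Balaban1983to89.B6MinimalOrbitV1
import Literature.MathematicalPhysics.QuantumFieldTheory.Balaban1983to89.B5Eq147TorusBridge
import Literature.MathematicalPhysics.QuantumFieldTheory.Balaban1983to89.B5Eq165GaugeMinimaV1

/-!
# `Balaban1983to89.B6SectAWholeTorusBridge` — T. Bałaban, *Propagators and renormalization transformations for lattice gauge
# theories. II*, Commun. Math. Phys. **96** (1984) 223–250 [Balaban1984PropagatorsII], Sect. A pp. 223–228 AT THE WHOLE-TORUS
# DOMAIN FAMILY `Ω₁ = … = Ω_k = T_η` (p. 223: ***"a generalization of the variational problem considered in Sect. D of [4] and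
# leading to the operator H_k"***; p. 224: ***"we admit the case when some domains Ω_j are equal to T_η"***) IS Sect. D of
# T. Bałaban, *Propagators and renormalization transformations for lattice gauge theories. I*, Commun. Math. Phys. **95** (1984)
# 17–40 [Balaban1984PropagatorsI], (1.47) p. 26, (1.63)–(1.65) pp. 28–29 (= T. Bałaban, J. Imbrie, A. Jaffe, CMP **97** (1985)
# [BalabanImbrieJaffe1985], (4.4.2) p. 312): KNITTING of p21's concrete multi-level Sect. A (`B6SectADomainsV1` … `B6MinimalOrbitV1`)
# with the one-level Landau-gauge files of p11 / p38 / this seat (`BIJ85LandauMinimizer442V1`, `B5Eq164LandauV1`,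
# `B5Eq165GaugeMinimaV1`, `B5Eq147TorusBridge`) — `N(Q′) = N(Q′_k)`, `R` of (2.10)–(2.12) = `R` of (1.47), (2.6) ⟺ `Q_kA = B`,
# (2.12) ⟺ the Landau gauge `{R∂*A = 0}`, **(2.35) `HB = GQ*(QGQ*)⁻¹B` = (4.4.2) `H_kB` = the closed form (1.63)**, (2.12)'s
# *"exactly one minimum on each orbit"* = the Landau gauge fixing of (1.47) for EVERY `k`, and the minimal orbit of (2.5)–(2.6) =
# `H_kB + ∂N(Q′_k)` with minimal value `½⟨B, Δ_kB⟩` of (1.65)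

statement-level skeleton of published theorems with citation tags; proofs where landed; nothing here is a claim about the
Yang–Mills mass gap

PDF held: `paper:balaban1984-cmp96-propagators-rt-ii` (journal page = PDF page + 222; pp. 223–224 [PDF 1–2] read from the
materialised text `~/.lit/texts/paper-balaban1984-cmp96-propagators-rt-ii/p0001.txt`, `p0002.txt`, this seat, 2026-08-21);
`paper:balaban1984-cmp95-propagators-rt-i` (journal page = PDF page + 16; pp. 25, 26, 28, 29 [PDF 9, 10, 12, 13], text layer, read by
this seat's lineage gens 2–4); `paper:balaban1985-cmp97-bij-higgs-minimizers` (journal page = PDF page + 298; p. 312 [PDF 14]).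

PRINT, verbatim.  [B6] p. 223, Sect. A, first sentence: «Let us begin with a generalization of the variational problem considered in
Sect. D of [4] and leading to the operator H_k. At first we have to describe a geometry of domains on which we will consider the
problem.»  p. 224, after (2.4): «Let us notice that we admit the case when some domains Ω_j are equal to T_η, for example Ω_j = T_η for
j = 1, 2, …, l, l ≤ k.»  p. 224: «We consider the functional A → Σ_p η^d|(∂A)(p)|² (2.5) for A fixed outside Ω₁ and with fixed averages
inside Ω₁, more exactly A = B₀ on Λ₀, Q_jA = B_j on Λ_j, j = 1, …, k. (2.6) The functional and the conditions are invariant with respect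
to gauge transformations λ: A → A^λ = A − ∂λ such that λ = 0 on Λ₀, Q′_jλ = 0 on Λ_j, j = 1, …, k. (2.7) … We want to find a minimal
orbit of the functional (2.5) under the restrictions (2.6). To solve this problem we have to fix a convenient gauge condition. We will
use a generalization of the gauge condition R∂*A = 0 defined and used in Sects. C and D of [4].»  p. 225: «N(Q′) = {λ: λ satisfies
(2.7)}, (2.10) and let R be an orthogonal projection in the space L²(T_η) onto the subspace ΔN(Q′) … Thus the functional (2.8) has
exactly one minimum on each orbit. This minimum satisfies the equation R∂*A^{λ₀} = 0, or R∂*A = 0 if we take A^{λ₀} as A. (2.12)»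
p. 228: «A = HB = GQ*(QGQ*)⁻¹B. (2.35) … there exists exactly one critical configuration of (2.5) satisfying (2.6), (2.12), and given
by (2.35).»  [B5] p. 25 ll. 2–4: «The projection operator R has a clear meaning. It is an orthogonal projection on the linear subspace
ΔN(Q′_k) of L²(T_η), N(Q′_k) = {λ : Q′_kλ = 0}.»  p. 26: «We have to calculate the integral … δ(B − Q_kA)δ_R(∂*A) exp(−½⟨∂A, ∂A⟩).
(1.47) With this integral an operator of fundamental importance is connected. It is defined on configurations B on the lattice
T₁^{(k)} and its value on such a configuration is equal to a configuration A on T_η minimizing the form ½⟨∂A, ∂A⟩ under the conditions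
Q_kA = B, R∂*A = 0.»  p. 28 l. 4: «This defines the operator H_kB = A»; p. 29: «H_kB is a minimum of ½⟨∂A, ∂A⟩ on the hyperplane
{A : Q_kA = B, R∂*A = 0} … (1.47) = Z_k exp(−½⟨∂H_kB, ∂H_kB⟩). (1.64) The action Δ_k is thus defined by ⟨B, Δ_kB⟩ = ⟨∂H_kB, ∂H_kB⟩.
(1.65)»  [BIJ85] p. 312: «Such a Faddeev-Popov type choice leads to the formula for the Landau gauge minimizer
H_kB = Z_k(B)⁻¹∫𝒟A δ(Q_kA − B)𝒢(∂*A) A exp(−½‖∂A‖²), (4.4.2)».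

CITATION HEADER (lean-in-tree rule) — WHAT IS REPRODUCED.  Phase-2 file of the `lit-balaban` typed skeleton (HOME
`run/shared/lean/pub/lit-balaban/`), seat **p16 gen 5** (B6 fold owner r03, B5 owner r02, C1 owner r15, referee ref-4): KNITTING of
the SKELETON rows **B6.Eq2.35** / **B6.Eq2.12** / **B6.Eq2.7** / **B6.Eq2.5** (decls of record on the V1 model: p21's
`B6SectACriticalPointV1.isCritical_iff_eq_hOp` / `existsUnique_gauge212`, `B6SectADomainsV1.Domains.InGauge`, `B6MinimalOrbitV1.IsMin25`
— untouched) with **B5.Eq1.47** / **B5.Eq1.63** / **B5.Eq1.64** (V1 `B5Eq164LandauV1.lan`, `B5Eq165GaugeMinimaV1.eq165_landau`, tower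
`B5HkOpLandauMin.hkT` via `B5Eq147TorusBridge.tVE_Hk` — untouched) and **C1.Eq4.4.1-4.4.3** ((4.4.2) `BIJ85LandauMinimizer442.Hk` on
`BIJ85LandauMinimizer442V1.opsV1 P k c s` — untouched), AT p21's whole-torus family `B6SectADomainsV1.Domains.whole k` (p21's
non-vacuity witness: «with l = k: all domains the whole torus (then Λ_j = ∅ for j < k and Λ_k = T^{(k)}: the one-level problem of
[Balaban1984PropagatorsI])» — the identification asserted there is PROVED here).  Carriers/objects BY NAME: `BondSpace P`/`ScalarSpace P`
(ℓ² on the bonds/sites of `T^{(0)}`), p21's `QE`/`QpE`/`dE`/`dsE`/`dcE`/`lapE`/`KE`/`RE`/`GE`/`EE`/`SameOrbit`/`IsMin25`, r03's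
`B6SectA.hOp`, `B6Eq218Lagrangian.{Admissible, IsCritical, energy}`, p11's `opsV1 P k c s` (`∂ = s·curl c`, `∂* = s·diverg c`,
`Δ = s·laplace c`, `Q_k = bondAvgIter k`, `Q′ = siteAvgIter k`), `LandauOps.{kerQp, gaugeRange, projR, Qk}`, `Hk`, `gradV1`, p38's
`lan`, `DeltaK P k (s²) c` ((1.19)), `curlAction`.  THEOREMS ONLY: no new definition, no `def … : Prop`, nothing is a named unproved
fact.  Companion file (this seat): `B6SectAWholeTorusData` — the reindexing `L²(𝔅) ≃ₗᵢ L²(bonds of T^{(k)})` and (2.35) = `H_kB` for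
EVERY datum `B` (here the data are parametrised as `QA₀`, which covers every datum since `Q` and `Q_k` are onto).

WHAT IS PROVED (kernel, no `sorry`, standard axioms; standing range `k ≤ m + K` of `Setup`; every `d ≥ 1`; `c ≠ 0` the lattice
factor, `s ≠ 0` the norm weight of p11's operators; every choice of p21's weights `a > 0` where `H` appears):
* §1 THE FAMILY UNFOLDS: `lamSite_whole_iff`/`lamBond_whole_iff` (`Λ_j = ∅` for `j ≠ k`, `Λ_k = T^{(k)}`), **`inGauge_whole_iff`**
  ((2.7) `N(Q′)` = `{λ : Q′_kλ = 0}`), **`constr_whole_iff`** ((2.6) ⟺ `Q_kA = B_k`).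
* §2 ONE SET OF OPERATORS: `ker_QpE_whole_eq` (`ker Q′ = (opsV1 P k c s).kerQp`), `lap_opsV1_eq_smul_lapE`/`dstar_…`/`curl_…`/
  `dE_eq_gradV1` (p11's operators are `s`·p21's), **`KE_whole_eq_gaugeRange`** (`ΔN(Q′) = ΔN(Q′_k)`), **`RE_whole_apply`/`RE_whole_eq`:
  p21's `R` IS p11's `projR`** — [B6] (2.10)'s projection is [B5] (1.47)'s `R` —, **`RE_dsE_whole_eq_zero_iff(_mem_lan)`** ((2.12) ⟺
  `R∂*A = 0` of (1.47) ⟺ `A ∈ lan P k c s`), `QE_whole_eq_iff` (same (2.20)-data ⟺ same `Q_kA`), `sameOrbit_whole_iff` ((2.7)'s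
  orbits = shifts by `∂λ`, `Q′_kλ = 0`).
* §3 THE HEADLINE: `admissible_whole_iff` ((2.6) ∧ (2.12) = [B5]'s hyperplane `{Q_kA = B, R∂*A = 0}`), **`hOp_whole_eq_Hk`:
  `B6SectA.hOp (GE …) (QsE …) (EE …) (QE A₀) = Hk (opsV1 P k c s) (Q_kA₀)`** — (2.35) at the whole torus IS (4.4.2)/(1.47)'s `H_k`, for
  every `A₀`, every `a > 0` (route: p21's `isCritical_hOp_V1` + `energy_hOp_le_V1` make `HB` a minimiser of `½‖∂A‖²` on the hyperplane;
  p11's `eq_Hk_of_isMinOn_curl_V1` identifies it); **`tVE_hOp_whole`** (carried to the tower it is the closed form (1.63) `hkT k (tB (Q_kA₀))`,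
  gen 4's `tVE_Hk`); `isCritical_whole_iff` (the unique critical configuration (2.21) is `H_k(Q_kA₀)`); **`existsUnique_landauGauge`**:
  (2.12) at the whole torus — for every `A` exactly one `λ ∈ N(Q′_k)` with `A − ∂λ ∈ {R∂*A = 0}`, EVERY `k` (gen 4's
  `B6Eq28LandauGaugeV1.existsUnique_landauGauge` was `k = 1`).
* §4 THE PROBLEM AS POSED: `isMin25_whole_iff` ((2.5)–(2.6) = minimise `½‖∂A‖²` on `{Q_kA = Q_kA₀}`), **`isMin25_whole_iff_mem_orbit`**
  (its solutions are exactly `H_k(Q_kA₀) − ∂λ`, `Q′_kλ = 0`), **`isMin25_whole_and_lan_iff`** (the Landau gauge selects `H_kB` — [B5]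
  p. 26's description of `H_k`), `isMin25_whole_value`, **`isMin25_whole_iff_curlAction`** (⟺ `Q_kA = B` and action `= ½⟨B, Δ_kB⟩`, p38's
  unconstrained minimum `isLeast_curlAction_avgFibre`), `isMin25_whole_value_eq165` (minimal value = (1.65)).

READINGS / HONEST SCOPE.  (a) U = 1 (real, abelian) fields throughout, as in every file knitted here.  (b) The whole-torus family
has `Λ₀ = ∅`: the clause *"A fixed outside Ω₁"* of (2.6) is void and (2.6) is the single constraint `Q_kA = B` of [B5] (1.18)/(1.47)
(`constr_whole_iff`); p21's `Domains` carries no metric clause of (2.2), so nothing is assumed about `M`, `R`.  (c) p11's `∂`, `∂*`,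
`Δ` carry the weight `s` (`s² = η^d`) and p21's do not (ℓ² pairings, volume factor dropped): the subspaces, projections, constraints and
minimisers agree for every `s ≠ 0` (§2), the functionals differ by the factor `s²/2` (`half_norm_curl_sq_eq_energy`) — no statement
depends on matching normalisations.  (d) Nothing is claimed about the general nested family beyond p21's theorems, which are used by
name; GAPS.md: nothing (every printed step went through).
-/

open scoped InnerProductSpace Matrix

namespace Literature.MathematicalPhysics.QuantumFieldTheory.Balaban1983to89.B6SectAWholeTorusBridge

open LatticeFieldCalculus B6SectADomainsV1 B6SectAOperatorsV1 B6SectAVectorModelV1 B6SectACriticalPointV1 B6MinimalOrbitV1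
open BalabanImbrieJaffe1984to88.BIJ85AxialPropagator411 (BondSpace PlaqSpace)
open B6Eq218Lagrangian (IsCritical Admissible)
open BalabanImbrieJaffe1984to88.BIJ85LandauForm441 (LandauOps)
open BalabanImbrieJaffe1984to88.BIJ85LandauMinimizer442 (Hk Zk)
open BalabanImbrieJaffe1984to88.BIJ85LandauMinimizer442V1 (opsV1 gradV1 opsV1_curl opsV1_dstar opsV1_lap opsV1_Qk opsV1_Qp)

noncomputable section

variable {P : Params} {k : ℕ} (hk : k ≤ P.m + P.K)

/-! ## §1. The whole-torus family unfolds: `Λ_j = ∅` (`j < k`), `Λ_k = T^{(k)}`, `N(Q′) = N(Q′_k)`, (2.6) ⟺ `Q_kA = B_k` -/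

/-- `Ω_j^{(j)} = T^{(j)}` for `j ≤ k`. [cite: Balaban1984PropagatorsII, (2.1) p.224] -/
theorem om_whole_of_le {j : ℕ} (hj : j ≤ k) : (Domains.whole (P := P) k hk).Om j = Finset.univ := by
  simp [Domains.whole, hj]

/-- `Ω_j^{(j)} = ∅` for `j > k`. [cite: Balaban1984PropagatorsII, (2.1) p.224] -/
theorem om_whole_of_lt {j : ℕ} (hj : k < j) : (Domains.whole (P := P) k hk).Om j = ∅ := by
  simp [Domains.whole, not_le.mpr hj]

/-- the top level of the whole-torus family is `k`. [cite: Balaban1984PropagatorsII, (2.1) p.224] -/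
@[simp] theorem k_whole : (Domains.whole (P := P) k hk).k = k := rfl

/-- a `j`-block is inside `Ω_{j+1} = T` iff `j < k`. [cite: Balaban1984PropagatorsII, (2.3) p.224] -/
theorem deep_whole_iff {j : ℕ} (y : Site P j) : (Domains.whole (P := P) k hk).Deep j y ↔ j < k := by
  unfold Domains.Deep
  by_cases h : j < k
  · simp [om_whole_of_le hk (Nat.succ_le_of_lt h), h]
  · simp [om_whole_of_lt hk (Nat.lt_succ_of_le (not_lt.mp h)), h]

/-- `Λ_j = ∅` for `j ≠ k` and `Λ_k = T^{(k)}` (sites). [cite: Balaban1984PropagatorsII, (2.3) p.224] -/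
theorem lamSite_whole_iff {j : ℕ} (y : Site P j) : (Domains.whole (P := P) k hk).LamSite j y ↔ j = k := by
  unfold Domains.LamSite
  rw [deep_whole_iff]
  by_cases h : j ≤ k
  · simp [om_whole_of_le hk h]; omega
  · simp [om_whole_of_lt hk (not_le.mp h)]; omega

/-- `Λ_j = ∅` for `j ≠ k` and `Λ_k = T^{(k)}` (bonds). [cite: Balaban1984PropagatorsII, (2.3) p.224] -/
theorem lamBond_whole_iff {j : ℕ} (b : PBond P j) : (Domains.whole (P := P) k hk).LamBond j b ↔ j = k := by
  unfold Domains.LamBond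
  rw [deep_whole_iff, deep_whole_iff]
  by_cases h : j ≤ k
  · simp [om_whole_of_le hk h]; omega
  · simp [om_whole_of_lt hk (not_le.mp h)]; omega

/-- **(2.7)/(2.10) at the whole torus: `N(Q′) = N(Q′_k) = {λ : Q′_kλ = 0}`**. [cite: Balaban1984PropagatorsII, (2.7) p.224 + (2.10) p.225] -/
theorem inGauge_whole_iff (lam : SiteField P 0 ℝ) :
    (Domains.whole (P := P) k hk).InGauge lam ↔ siteAvgIter k lam = 0 := by
  constructor
  · intro h
    funext y
    exact h k y ((lamSite_whole_iff hk y).mpr rfl)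
  · intro h j y hy
    obtain rfl := (lamSite_whole_iff hk y).mp hy
    rw [h]; rfl

/-- **(2.6)/(2.20) at the whole torus: the constraints are `Q_kA = B_k` on all of `T^{(k)}`**. [cite: Balaban1984PropagatorsII, (2.6) p.224 + (2.20) p.226] -/
theorem constr_whole_iff (A : VecField P 0 ℝ) (B : (j : ℕ) → VecField P j ℝ) :
    (Domains.whole (P := P) k hk).Constr A B ↔ bondAvgIter k A = B k := by
  constructor
  · intro h
    funext b
    exact h k b ((lamBond_whole_iff hk b).mpr rfl)
  · intro h j b hb
    obtain rfl := (lamBond_whole_iff hk b).mp hb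
    rw [h]


/-! ## §2. The operators at the whole torus: `N(Q′) = ker Q′_k`, `ΔN(Q′)`, **`R` of (2.10)–(2.12) IS `R` of [B5] (1.47)** -/

variable {c s : ℝ}

/-- `N(Q′) = ker Q′` of (2.10) at the whole torus is `N(Q′_k) = {λ : Q′_kλ = 0}` of [B5] p. 25, read on `L²(T_η)`. [cite: Balaban1984PropagatorsII, (2.10) p.225] -/
theorem mem_ker_QpE_whole_iff (f : ScalarSpace P) :
    f ∈ LinearMap.ker (QpE (Domains.whole (P := P) k hk)) ↔ siteAvgIter k (WithLp.ofLp f) = 0 := by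
  rw [mem_ker_QpE_iff, inGauge_whole_iff]

/-- … and it is p11's `N(Q′_k) = (opsV1 P k c s).kerQp` (every `c`, `s`). [cite: Balaban1984PropagatorsI, p.25 (text)] -/
theorem ker_QpE_whole_eq (c s : ℝ) :
    LinearMap.ker (QpE (Domains.whole (P := P) k hk)) = (opsV1 P k c s).kerQp := by
  ext f
  rw [mem_ker_QpE_whole_iff, LandauOps.mem_kerQp, opsV1_Qp]

/-- `Δ = ∂*∂` of (2.8) and p11's `Δ = s·laplace c`: `(opsV1 P k c s).lap = s • lapE c`. [cite: Balaban1984PropagatorsII, (2.8) p.224] -/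
theorem lap_opsV1_eq_smul_lapE (c s : ℝ) : (opsV1 P k c s).lap = s • lapE (P := P) c := by
  refine LinearMap.ext fun f => ?_
  rw [opsV1_lap, LinearMap.smul_apply]
  congr 1
  exact (WithLp.ofLp_injective 2) (by rw [WithLp.ofLp_toLp, ofLp_lapE])

/-- `∂*` of (2.8) and p11's `∂* = s·diverg c`: `(opsV1 P k c s).dstar = s • dsE c`. [cite: Balaban1984PropagatorsII, (2.8) p.224] -/
theorem dstar_opsV1_eq_smul_dsE (c s : ℝ) : (opsV1 P k c s).dstar = s • dsE (P := P) c :=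
  LinearMap.ext fun _ => rfl

/-- `∂` on vector fields of (2.5) and p11's `∂ = s·curl c`: `(opsV1 P k c s).curl = s • dcE c`. [cite: Balaban1984PropagatorsII, (2.5) p.224] -/
theorem curl_opsV1_eq_smul_dcE (c s : ℝ) : (opsV1 P k c s).curl = s • dcE (P := P) c :=
  LinearMap.ext fun _ => rfl

/-- the gauge directions `∂λ` of (2.7) are p11's V1 gauge gradient `gradV1`. [cite: Balaban1984PropagatorsII, (2.7) p.224] -/
theorem dE_eq_gradV1 (c : ℝ) : dE (P := P) c = gradV1 P c := LinearMap.ext fun _ => rfl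

/-- **`ΔN(Q′)` of (2.10) at the whole torus IS [B5]'s `R`-subspace `ΔN(Q′_k)`** (p. 25 *"Let us denote this subspace by R also,
R = ΔN(Q′_k)"*; p11's `LandauOps.gaugeRange`), every `c`, every `s ≠ 0`. [cite: Balaban1984PropagatorsI, p.25 (text)] -/
theorem KE_whole_eq_gaugeRange (c : ℝ) (hs : s ≠ 0) :
    KE (Domains.whole (P := P) k hk) c = (opsV1 P k c s).gaugeRange := by
  rw [KE, LandauOps.gaugeRange, ← ker_QpE_whole_eq hk c s, lap_opsV1_eq_smul_lapE, Submodule.map_smul _ _ _ hs]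

/-- orthogonal projections onto equal subspaces agree. [folklore] -/
private theorem starProjection_congr {E : Type*} [NormedAddCommGroup E] [InnerProductSpace ℝ E] {U V : Submodule ℝ E}
    [U.HasOrthogonalProjection] [V.HasOrthogonalProjection] (h : U = V) (x : E) :
    U.starProjection x = V.starProjection x := by
  subst h
  rfl

/-- **`R` of (2.10)–(2.12) at the whole torus IS `R` of [B5] (1.47)** (p. 25 *"It is an orthogonal projection on the linear
subspace ΔN(Q′_k) of L²(T_η)"*; p11's `LandauOps.projR`), every `c`, every `s ≠ 0`. [cite: Balaban1984PropagatorsI, p.25 (text)] -/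
theorem RE_whole_apply (c : ℝ) (hs : s ≠ 0) (f : ScalarSpace P) :
    RE (Domains.whole (P := P) k hk) c f = (opsV1 P k c s).projR f := by
  rw [RE_apply]
  exact starProjection_congr (KE_whole_eq_gaugeRange hk c hs) f

/-- as linear maps. [cite: Balaban1984PropagatorsII, (2.10)–(2.12) p.225] -/
theorem RE_whole_eq (c : ℝ) (hs : s ≠ 0) :
    RE (Domains.whole (P := P) k hk) c = ((opsV1 P k c s).projR : ScalarSpace P →L[ℝ] ScalarSpace P).toLinearMap :=
  LinearMap.ext fun f => RE_whole_apply hk c hs f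

/-- **the gauge condition (2.12) `R∂*A = 0` at the whole torus IS the Landau gauge `R∂*A = 0` of [B5] (1.47)**
(p38's `B5Eq164LandauV1.lan P k c s = {A : R∂*A = 0}`), every `c`, every `s ≠ 0`. [cite: Balaban1984PropagatorsI, (1.47) p.26] -/
theorem RE_dsE_whole_eq_zero_iff (c : ℝ) (hs : s ≠ 0) (x : BondSpace P) :
    RE (Domains.whole (P := P) k hk) c (dsE c x) = 0 ↔ (opsV1 P k c s).projR ((opsV1 P k c s).dstar x) = 0 := by
  rw [RE_whole_apply hk c hs, dstar_opsV1_eq_smul_dsE, LinearMap.smul_apply, map_smul, smul_eq_zero, or_iff_right hs]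

/-- … as membership in the Landau subspace `lan`. [cite: Balaban1984PropagatorsI, (1.47) p.26] -/
theorem RE_dsE_whole_eq_zero_iff_mem_lan (c : ℝ) (hs : s ≠ 0) (x : BondSpace P) :
    RE (Domains.whole (P := P) k hk) c (dsE c x) = 0 ↔ x ∈ B5Eq164LandauV1.lan P k c s := by
  rw [RE_dsE_whole_eq_zero_iff hk c hs, B5Eq164LandauV1.mem_lan]

/-- **(2.6)/(2.20) at the whole torus on `L²`**: two configurations have the same multi-scale data `QA` iff they have the same
`k`-fold average `Q_kA` ((1.18) of [B5]). [cite: Balaban1984PropagatorsII, (2.6) p.224 + (2.20) p.226] -/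
theorem QE_whole_eq_iff (c s : ℝ) (x y : BondSpace P) :
    QE (Domains.whole (P := P) k hk) x = QE (Domains.whole (P := P) k hk) y ↔ (opsV1 P k c s).Qk x = (opsV1 P k c s).Qk y := by
  rw [← sub_eq_zero, ← map_sub, QE_eq_zero_iff, ← sub_eq_zero (a := (opsV1 P k c s).Qk x), ← map_sub, opsV1_Qk]
  constructor
  · intro h
    funext b
    exact h k b ((lamBond_whole_iff hk b).mpr rfl)
  · intro h j b hb
    obtain rfl := (lamBond_whole_iff hk b).mp hb
    rw [h]
    rfl

/-- componentwise: the `𝔅`-datum of `A` at the index `b ∈ Λ_k = T^{(k)}` is `(Q_kA)(b)`. [cite: Balaban1984PropagatorsII, (2.20) p.226] -/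
theorem QE_whole_apply (x : BondSpace P) (i : BondIdx (Domains.whole (P := P) k hk)) :
    QE (Domains.whole (P := P) k hk) x i = bondAvgIter (i.1.1 : ℕ) (WithLp.ofLp x) i.1.2 := rfl

/-- every index of `𝔅` sits at the top level `k`. [cite: Balaban1984PropagatorsII, (2.3)–(2.4) p.224] -/
theorem bondIdx_whole_level (i : BondIdx (Domains.whole (P := P) k hk)) : (i.1.1 : ℕ) = k :=
  (lamBond_whole_iff hk i.1.2).mp i.2

/-- **the gauge group (2.7) at the whole torus IS the restricted gauge group `λ ∈ N(Q′_k)` of [B5] (1.20)/(1.47)**: the orbit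
relation of p21's `SameOrbit`. [cite: Balaban1984PropagatorsII, (2.7) p.224] -/
theorem sameOrbit_whole_iff (c : ℝ) (x y : BondSpace P) :
    SameOrbit (Domains.whole (P := P) k hk) c x y ↔
      ∃ n : ScalarSpace P, siteAvgIter k (WithLp.ofLp n) = 0 ∧ y = x - gradV1 P c n := by
  simp only [SameOrbit, mem_ker_QpE_whole_iff, dE_eq_gradV1]

/-! ## §3. ***"leading to the operator H_k"***: (2.35) at the whole torus IS (4.4.2)/(1.63) `H_k`; (2.12)'s *"exactly one minimum on
each orbit"* IS the Landau gauge fixing of (1.47), every `k` -/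

/-- the admissible set (2.6) ∧ (2.12) at the whole torus is [B5]'s hyperplane `{A : Q_kA = B, R∂*A = 0}` of p. 26/p. 29
(`B = Q_kA₀`). [cite: Balaban1984PropagatorsI, p.26 (text)] -/
theorem admissible_whole_iff (c : ℝ) (hs : s ≠ 0) (x₀ x : BondSpace P) :
    Admissible (QE (Domains.whole (P := P) k hk)) (dsE c) (RE (Domains.whole (P := P) k hk) c)
        (QE (Domains.whole (P := P) k hk) x₀) x ↔
      (opsV1 P k c s).Qk x = (opsV1 P k c s).Qk x₀ ∧ (opsV1 P k c s).projR ((opsV1 P k c s).dstar x) = 0 := by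
  rw [Admissible, QE_whole_eq_iff hk c s, RE_dsE_whole_eq_zero_iff hk c hs]

/-- the functional (2.5) `‖∂A‖²` (p21's `energy (dcE c)`) and [B5]'s `½⟨∂A, ∂A⟩ = ½‖(opsV1 P k c s).curl A‖²` differ by the
factor `s²/2`. [cite: Balaban1984PropagatorsII, (2.5) p.224] -/
theorem half_norm_curl_sq_eq_energy (c s : ℝ) (x : BondSpace P) :
    (1 / 2 : ℝ) * ‖(opsV1 P k c s).curl x‖ ^ 2 = s ^ 2 / 2 * B6Eq218Lagrangian.energy (dcE c) x := by
  rw [B6Eq218Lagrangian.energy, curl_opsV1_eq_smul_dcE, LinearMap.smul_apply, norm_smul, mul_pow, Real.norm_eq_abs, sq_abs]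
  ring

/-- ***"a generalization of the variational problem considered in Sect. D of [4] and leading to the operator H_k"*** (p. 223),
AT THE WHOLE TORUS THE GENERALIZATION IS `H_k` ITSELF: the configuration (2.35) `HB = GQ*(QGQ*)⁻¹B` of the whole-torus family on
the datum `B = QA₀` equals the Landau-gauge minimiser (4.4.2) `H_k(Q_kA₀)` of [BalabanImbrieJaffe1985] / the operator `H_k` of
[B5] (1.47)/(1.63) — every `A₀`, every `c, s ≠ 0`, every choice of weights `a > 0`. [cite: Balaban1984PropagatorsII, p.223 (text) + (2.35) p.228] -/
theorem hOp_whole_eq_Hk (hc : c ≠ 0) (hs : s ≠ 0) {w : BondIdx (Domains.whole (P := P) k hk) → ℝ} (hw : ∀ i, 0 < w i)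
    (x₀ : BondSpace P) :
    B6SectA.hOp (GE (Domains.whole (P := P) k hk) hc hw) (QsE (Domains.whole (P := P) k hk))
        (EE (Domains.whole (P := P) k hk) hc hw) (QE (Domains.whole (P := P) k hk) x₀) =
      Hk (opsV1 P k c s) ((opsV1 P k c s).Qk x₀) := by
  have hcrit := isCritical_hOp_V1 (Domains.whole (P := P) k hk) hc hw (QE (Domains.whole (P := P) k hk) x₀)
  have hadm := (admissible_whole_iff hk c hs x₀ _).mp hcrit.1
  refine BalabanImbrieJaffe1984to88.BIJ85LandauMinimizer442V1.eq_Hk_of_isMinOn_curl_V1 hk hc hs hadm.1 hadm.2 ?_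
  intro A hA
  have hA' := (admissible_whole_iff hk c hs x₀ A).mpr hA
  have h := energy_hOp_le_V1 (Domains.whole (P := P) k hk) hc hw (QE (Domains.whole (P := P) k hk) x₀) hA'
  show (1 / 2 : ℝ) * ‖(opsV1 P k c s).curl _‖ ^ 2 ≤ (1 / 2 : ℝ) * ‖(opsV1 P k c s).curl A‖ ^ 2
  rw [half_norm_curl_sq_eq_energy, half_norm_curl_sq_eq_energy]
  exact mul_le_mul_of_nonneg_left h (by positivity)

/-- **(2.35) at the whole torus = the closed-form (1.63) on the tower**: carried to the torus `Tor (towerM L Mk k)` by gen 4's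
isometric reindexing `tVE`, the whole-torus `HB` (`B = QA₀`) is Bałaban's explicit operator `H_k` of (1.63) applied to `tB(Q_kA₀)`
(`B5HkOpLandauMin.hkT` = `B5Hk163Torus.HkOp (L^k) Mk` pulled back). [cite: Balaban1984PropagatorsI, (1.63) p.28] -/
theorem tVE_hOp_whole (hc : c ≠ 0) (hs : s ≠ 0) {w : BondIdx (Domains.whole (P := P) k hk) → ℝ} (hw : ∀ i, 0 < w i)
    (x₀ : BondSpace P) :
    B5Eq147TorusBridge.tVE P hk (B6SectA.hOp (GE (Domains.whole (P := P) k hk) hc hw) (QsE (Domains.whole (P := P) k hk))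
        (EE (Domains.whole (P := P) k hk) hc hw) (QE (Domains.whole (P := P) k hk) x₀)) =
      B5HkOpLandauMin.hkT P.L (B5Eq117TorusCarriers.Mk P k) k
        (B5Eq117TorusCarriers.tB (bondAvgIter k (WithLp.ofLp x₀))) := by
  rw [hOp_whole_eq_Hk hk hc hs hw x₀, B5Eq147TorusBridge.tVE_Hk hk hc hs, opsV1_Qk]

/-- the critical configurations (2.21) of (2.5) under (2.6), (2.12) at the whole torus: exactly `H_k(Q_kA₀)`. [cite: Balaban1984PropagatorsII, (2.35) p.228] -/
theorem isCritical_whole_iff (hc : c ≠ 0) (hs : s ≠ 0) (x₀ x : BondSpace P) :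
    IsCritical (dcE c) (QE (Domains.whole (P := P) k hk)) (dsE c) (RE (Domains.whole (P := P) k hk) c)
        (QE (Domains.whole (P := P) k hk) x₀) x ↔
      x = Hk (opsV1 P k c s) ((opsV1 P k c s).Qk x₀) := by
  have hw : ∀ i : BondIdx (Domains.whole (P := P) k hk), 0 < (fun _ => (1 : ℝ)) i := fun _ => one_pos
  rw [isCritical_iff_eq_hOp _ hc hw, hOp_whole_eq_Hk hk hc hs hw]

include hk in
/-- **(2.12) at the whole torus, every `k`: *"the functional (2.8) has exactly one minimum on each orbit"*** — for every `A`
there is exactly one `λ ∈ N(Q′_k)` with `A − ∂λ` in the Landau gauge `{R∂*A = 0}` of [B5] (1.47) (gen 4's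
`B6Eq28LandauGaugeV1.existsUnique_landauGauge` was the case `k = 1`). [cite: Balaban1984PropagatorsII, (2.12) p.225] -/
theorem existsUnique_landauGauge (hc : c ≠ 0) (hs : s ≠ 0) (x : BondSpace P) :
    ∃! n : ScalarSpace P, siteAvgIter k (WithLp.ofLp n) = 0 ∧ x - gradV1 P c n ∈ B5Eq164LandauV1.lan P k c s := by
  have h := existsUnique_gauge212 (Domains.whole (P := P) k hk) hc x
  simp only [mem_ker_QpE_whole_iff, RE_dsE_whole_eq_zero_iff_mem_lan hk c hs, dE_eq_gradV1] at h
  exact h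

/-! ## §4. The variational problem (2.5)–(2.6) AS POSED (no gauge condition) at the whole torus: the minimisers of `½⟨∂A, ∂A⟩`
under `Q_kA = B` alone form the orbit `H_kB + ∂N(Q′_k)`; the Landau gauge selects `H_kB` -/

/-- p21's `IsMin25` at the whole torus: `A` minimises `½‖∂A‖²` on [B5]'s fibre `{Q_kA = Q_kA₀}`. [cite: Balaban1984PropagatorsII, (2.5)–(2.6) p.224] -/
theorem isMin25_whole_iff (c : ℝ) (hs : s ≠ 0) (x₀ x : BondSpace P) :
    IsMin25 (Domains.whole (P := P) k hk) c (QE (Domains.whole (P := P) k hk) x₀) x ↔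
      (opsV1 P k c s).Qk x = (opsV1 P k c s).Qk x₀ ∧
        ∀ y : BondSpace P, (opsV1 P k c s).Qk y = (opsV1 P k c s).Qk x₀ →
          (1 / 2 : ℝ) * ‖(opsV1 P k c s).curl x‖ ^ 2 ≤ (1 / 2 : ℝ) * ‖(opsV1 P k c s).curl y‖ ^ 2 := by
  have hs2 : (0 : ℝ) < s ^ 2 / 2 := by positivity
  simp only [IsMin25, QE_whole_eq_iff hk c s, half_norm_curl_sq_eq_energy, mul_le_mul_iff_of_pos_left hs2]

/-- **the minimal orbit at the whole torus**: `A` minimises `½⟨∂A, ∂A⟩` under `Q_kA = Q_kA₀` alone iff `A = H_k(Q_kA₀) − ∂λ` for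
some `λ ∈ N(Q′_k)`. [cite: Balaban1984PropagatorsII, (2.5)–(2.7) p.224 + (2.35) p.228] -/
theorem isMin25_whole_iff_mem_orbit (hc : c ≠ 0) (hs : s ≠ 0) (x₀ x : BondSpace P) :
    IsMin25 (Domains.whole (P := P) k hk) c (QE (Domains.whole (P := P) k hk) x₀) x ↔
      ∃ n : ScalarSpace P, siteAvgIter k (WithLp.ofLp n) = 0 ∧ x = Hk (opsV1 P k c s) ((opsV1 P k c s).Qk x₀) - gradV1 P c n := by
  have hw : ∀ i : BondIdx (Domains.whole (P := P) k hk), 0 < (fun _ => (1 : ℝ)) i := fun _ => one_pos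
  rw [isMin25_iff_mem_orbit _ hc hw, sameOrbit_whole_iff, hOp_whole_eq_Hk hk hc hs hw]

/-- **the Landau gauge selects `H_kB` on the minimal orbit** ([B5] p. 26: *"a configuration A on T_η minimizing the form
½⟨∂A, ∂A⟩ under the conditions Q_kA = B, R∂*A = 0"*): a minimiser of `½⟨∂A, ∂A⟩` under `Q_kA = Q_kA₀` lies in `{R∂*A = 0}` iff it
is `H_k(Q_kA₀)`. [cite: Balaban1984PropagatorsI, (1.47) p.26] -/
theorem isMin25_whole_and_lan_iff (hc : c ≠ 0) (hs : s ≠ 0) (x₀ x : BondSpace P) :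
    IsMin25 (Domains.whole (P := P) k hk) c (QE (Domains.whole (P := P) k hk) x₀) x ∧ x ∈ B5Eq164LandauV1.lan P k c s ↔
      x = Hk (opsV1 P k c s) ((opsV1 P k c s).Qk x₀) := by
  have hw : ∀ i : BondIdx (Domains.whole (P := P) k hk), 0 < (fun _ => (1 : ℝ)) i := fun _ => one_pos
  rw [← RE_dsE_whole_eq_zero_iff_mem_lan hk c hs, isMin25_and_gauge_iff _ hc hw, hOp_whole_eq_Hk hk hc hs hw]

/-- the minimal value: every minimiser of `½⟨∂A, ∂A⟩` under `Q_kA = Q_kA₀` has the energy of `H_k(Q_kA₀)` (the exponent of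
[B5] (1.64) `(1.47) = Z_k exp(−½⟨∂H_kB, ∂H_kB⟩)`). [cite: Balaban1984PropagatorsI, (1.64) p.29] -/
theorem isMin25_whole_value (hc : c ≠ 0) (hs : s ≠ 0) {x₀ x : BondSpace P}
    (hx : IsMin25 (Domains.whole (P := P) k hk) c (QE (Domains.whole (P := P) k hk) x₀) x) :
    (1 / 2 : ℝ) * ‖(opsV1 P k c s).curl x‖ ^ 2 =
      (1 / 2 : ℝ) * ‖(opsV1 P k c s).curl (Hk (opsV1 P k c s) ((opsV1 P k c s).Qk x₀))‖ ^ 2 := by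
  have hw : ∀ i : BondIdx (Domains.whole (P := P) k hk), 0 < (fun _ => (1 : ℝ)) i := fun _ => one_pos
  rw [half_norm_curl_sq_eq_energy, half_norm_curl_sq_eq_energy, isMin25_energy_eq _ hc hw hx, hOp_whole_eq_Hk hk hc hs hw]


/-- **(2.5)–(2.6) at the whole torus ⟺ [B5]'s unconstrained-gauge minimum (1.65)**: `A` solves the variational problem as posed iff
`Q_kA = Q_kA₀ =: B` and its action `½⟨∂A, ∂A⟩` is `½⟨B, Δ_kB⟩`, the least action over ALL of `{Q_kA = B}` (p38's
`B5Eq165GaugeMinimaV1.isLeast_curlAction_avgFibre`, `Δ_k` = the (1.19) form `B5Eq119GaussianV1.DeltaK P k (s²) c`). [cite: Balaban1984PropagatorsI, (1.65) p.29] -/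
theorem isMin25_whole_iff_curlAction (hc : c ≠ 0) (hs : s ≠ 0) (x₀ x : BondSpace P) :
    IsMin25 (Domains.whole (P := P) k hk) c (QE (Domains.whole (P := P) k hk) x₀) x ↔
      bondAvgIter k (WithLp.ofLp x) = bondAvgIter k (WithLp.ofLp x₀) ∧
        curlAction (s ^ 2) c (WithLp.ofLp x) =
          (1 / 2 : ℝ) * (bondAvgIter k (WithLp.ofLp x₀) ⬝ᵥ
            (B5Eq119GaussianV1.DeltaK P k (s ^ 2) c *ᵥ bondAvgIter k (WithLp.ofLp x₀))) := by
  have hL := B5Eq165GaugeMinimaV1.isLeast_curlAction_avgFibre hk (by positivity : (0 : ℝ) < s ^ 2) hc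
    (bondAvgIter k (WithLp.ofLp x₀))
  rw [isMin25_whole_iff hk c hs]
  simp only [opsV1_Qk, B5Eq165GaugeMinimaV1.half_norm_curl_sq]
  constructor
  · rintro ⟨hQ, hmin⟩
    refine ⟨hQ, le_antisymm ?_ (hL.2 ⟨_, hQ, rfl⟩)⟩
    obtain ⟨A₁, hA₁, hval⟩ := hL.1
    have h := hmin (WithLp.toLp 2 A₁) (by rw [WithLp.ofLp_toLp]; exact hA₁)
    rwa [WithLp.ofLp_toLp, hval] at h
  · rintro ⟨hQ, hval⟩
    exact ⟨hQ, fun y hy => hval ▸ hL.2 ⟨_, hy, rfl⟩⟩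

/-- … in particular the minimal value of (2.5) under (2.6) at the whole torus is `½⟨B, Δ_kB⟩ = ½‖∂H_kB‖²` of [B5] (1.64)/(1.65)
(p38's `eq165_landau`). [cite: Balaban1984PropagatorsI, (1.65) p.29] -/
theorem isMin25_whole_value_eq165 (hc : c ≠ 0) (hs : s ≠ 0) {x₀ x : BondSpace P}
    (hx : IsMin25 (Domains.whole (P := P) k hk) c (QE (Domains.whole (P := P) k hk) x₀) x) :
    (1 / 2 : ℝ) * ‖(opsV1 P k c s).curl x‖ ^ 2 =
      (1 / 2 : ℝ) * ((opsV1 P k c s).Qk x₀ ⬝ᵥ (B5Eq119GaussianV1.DeltaK P k (s ^ 2) c *ᵥ (opsV1 P k c s).Qk x₀)) := by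
  rw [isMin25_whole_value hk hc hs hx, B5Eq165GaugeMinimaV1.eq165_landau hk hc hs]

end

end Literature.MathematicalPhysics.QuantumFieldTheory.Balaban1983to89.B6SectAWholeTorusBridge
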